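import Summits.BirchSwinnertonDyer.BirchSwinnertonDyer.Theorems.GenusKolyvaginAtTwoGenusPrimitiveSupplyAtTwoOfKernelsDuality
import Summits.BirchSwinnertonDyer.BirchSwinnertonDyer.Theorems.SchneiderFreeAdditiveX3PoitouTateReciprocitySumHolds
import Summits.BirchSwinnertonDyer.Rank1Residual.GaloisImage.LocalEulerPoincareCharacteristicHolds
import HarnessLib

/-!
# Route `GenusKolyvaginAtTwo`, crux #2 `GenusPrimitiveSupplyAtTwo` (stmt-BirchSwinnertonDyer-22136):
# the two duality binders {Poitou–Tate (real places), Tate χ} DISCHARGED in the lineage's closers —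
# stub A ⟸ {Modularity, 2-parity, Cassels–Tate} ∧ (CONV₂); the crux BY NAME ⟸ {Modularity, 2-parity, Cassels–Tate,
# Gross–Zagier} ∧ (CONV₂) ∧ (CONV₂′) ∧ (U); Mazur–Rubin Cor. 3.4 (i) (`dim V_T = 2`) over every number field, unconditionally

Lead seat `bsd-line-gk2-p1` g9 (cell `bsd-f1-sign2`). THEOREMS ONLY (no definition, no named fact, no `sorry`); helper
`--supports stmt-BirchSwinnertonDyer-22136`; no item is closed here (item 24950 `MazurRubinProp52Rat` was closed by the
sibling file `…GenusKolyvaginAtTwoMazurRubinProp52Rat`); BSD is not proved by any of this.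

WHY. The g8 files of this lineage (`…TwistSelmerTransferDownTwo`, `…LoweringStep`, `…TwinSupplyDuality`,
`…OfKernelsDuality`) carry `hPT : poitouTate_selmerStructure_duality_real K` and
`hEP : ∀ v, localEulerPoincareCharacteristic K_v` as displayed binders. Both are THEOREMS of the tree —
`SchneiderFreeAdditiveX3.PoitouTateReduction.poitouTate_selmerStructure_duality_real_holds` (every number field; Milne ADT
I Thm. 4.10 (b) with real places) and `localEulerPoincareCharacteristic_holds` (every non-archimedean local field of
characteristic `0`; Milne ADT I Thm. 2.8). This file feeds them:

* §0 `localEP K` — Tate χ at every finite place `K_v` (the `CharZero K_v` instance from the injectivity of `K → K_v`); the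
  Poitou–Tate binder is fed directly by `PoitouTateReduction.poitouTate_selmerStructure_duality_real_holds (K := K)`.
* §1 `natCard_selmerGroup_mul_four_eq_of_transverse_of_pair_unconditional`, `natCard_selmerGroup_twist_mul_four_eq_of_places_unconditional` —
  Mazur–Rubin Cor. 3.4 (i) with `dim V_T = 2` (`#Sel₂(Y) · 4 = #Sel₂(E)` for a congruent pair / a twist pair) over EVERY
  number field, now UNCONDITIONAL.
* §2 `prop52_of_hasSurjectiveModNGaloisRep_unconditional`, `exists_prime_card_selmerGroup_quadraticTwist_mul_four_eq_unconditional` — the `ρ̄₂`-onto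
  lowering prime over `ℚ`, unconditional.
* §3 `minimalSelmerTwinSupply_of_print` — (SUPPLY) for the habitat from {Modularity, 2-parity, Cassels–Tate} only;
  `stub_minimalTwinSupplyAtTwo_of_print_of_twoConverse` — the REGISTERED stub `stub_minimalTwinSupplyAtTwo` of line
  `genus-supply` VERBATIM from {Modularity, 2-parity, Cassels–Tate} ∧ (CONV₂).
* §4 `genusPrimitiveSupplyAtTwo_of_print_of_twoConverse_of_multiGenus` and, in route-item vocabulary,
  `genusPrimitiveSupplyAtTwo_of_kernels : MultiGenusPrimitivityAtTwo → RankOneTwoConverse →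
  RankOneTwoConverseOffSemistableAtTwo → ModularityExistsNewform → TwoParityDD → CasselsTatePairingRat →
  GrossZagierAllLevels → GenusPrimitiveSupplyAtTwo` — THE CRUX BY NAME with every displayed antecedent a ROUTE ITEM
  (24947, 19220, 24948, 19382, 24949, 19420, 24148) and nothing else.

Honest framing: crux 22136 is OPEN exactly at (U) = item 24947 (lineage verdict g4–g8: odd-twist `2`-primitivity =
W. Zhang's base case at `p = 2`, misstated as typed at DEF ≥ 3) ∧ (CONV₂) = items 19220/24948 (the rank-one `2`-converse).
This file only shortens the PRINT side of the cone. BSD is not proved by any of this.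

References: [MazurRubin2010] arXiv:0904.3709: Prop. 3.3, Cor. 3.4 (i), Lemma 3.6, Prop. 5.2; [MilneADT2006] I Thm. 2.8,
Thm. 4.10; [GrossZagier1986] Thm. I.6.3; [DokchitserDokchitserAnnals2010] Thm. 1.4; [GrossLMS1991] §3 (3.5), §4 (4.1).
-/

set_option linter.dupNamespace false -- tree convention: `Summit.BirchSwinnertonDyer.BirchSwinnertonDyer.Theorems` (summit = sub-problem)
set_option autoImplicit false

noncomputable section

open scoped Classical ContRepresentation

namespace Summit.BirchSwinnertonDyer.BirchSwinnertonDyer.Theorems.GenusKolyLowering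

open WeierstrassCurve Field NumberField IsDedekindDomain Function
open Literature.NumberTheory.EllipticCurves Literature.NumberTheory.EllipticCurves.ModularForms
open Literature.NumberTheory.GaloisRepresentations
open Literature.NumberTheory.GaloisRepresentations.DiscreteGaloisModule (SelmerStructure)
open Literature.NumberTheory.GaloisCohomology
open Summit.BirchSwinnertonDyer.BirchSwinnertonDyer.Theorems.GenusKoly
open Summit.BirchSwinnertonDyer.BirchSwinnertonDyer.Theses.GenusKolyvaginAtTwo
open Summit.BirchSwinnertonDyer.BirchSwinnertonDyer.Theorems.SchneiderFreeAdditiveX3.PoitouTateReduction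
  (poitouTate_selmerStructure_duality_real_holds)

/-! ## §0 The discharge term for Tate χ -/

section Discharge

variable (K : Type) [Field K] [NumberField K]

/-- **Tate's local Euler–Poincaré characteristic formula at every finite place `K_v`** — the binder `hEP` of the lineage's
transfer theorems, fed by the tree theorem `localEulerPoincareCharacteristic_holds` (the `CharZero K_v` instance from the
injectivity of `K → K_v`). [cite: MilneADT2006, Ch. I, Thm. 2.8 (p. 31)] -/
theorem localEP : ∀ v : HeightOneSpectrum (𝓞 K), localEulerPoincareCharacteristic (v.adicCompletion K) := fun v ↦
  haveI : CharZero (v.adicCompletion K) := charZero_of_injective_algebraMap (algebraMap K _).injective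
  localEulerPoincareCharacteristic_holds (v.adicCompletion K)

end Discharge

/-! ## §1 Mazur–Rubin Cor. 3.4 (i) with `dim V_T = 2` over every number field — unconditional -/

section Down

variable {K : Type} [Field K] [NumberField K] (W Y : WeierstrassCurve K) [W.IsElliptic]

/-- **Mazur–Rubin Cor. 3.4 (i) with `dim V_T = 2` for a congruent pair `Y[2] ≅ E[2]` over a number field `K`,
UNCONDITIONALLY: `#Sel₂(Y) · 4 = #Sel₂(E)`** — `natCard_selmerGroup_mul_four_eq_of_transverse_of_pair` with its two duality
binders discharged (§0). Hypotheses: inverse `Γ_K`-intertwinings `φ, ψ`; the transported Kummer structure `𝓐 = φ_*𝓚_Y`; one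
finite `v₀ ∤ 2` where `𝓐` agrees with `𝓚_E` elsewhere and is transverse at `v₀`; two Selmer classes whose `v₀`-localisations
span a Klein four-group. [cite: MazurRubin2010, Prop. 3.3, Cor. 3.4 (i) and proof of Prop. 5.2 (arXiv:0904.3709 pp. 8–9, 12)]
[cite: MilneADT2006, Ch. I, Thm. 2.8 and Thm. 4.10] -/
theorem natCard_selmerGroup_mul_four_eq_of_transverse_of_pair_unconditional
    (φ : (Y.torsionGaloisModule ((2 : ℕ) : ℤ)).toContRepresentation →ⁱL
      (W.torsionGaloisModule ((2 : ℕ) : ℤ)).toContRepresentation)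
    (ψ : (W.torsionGaloisModule ((2 : ℕ) : ℤ)).toContRepresentation →ⁱL
      (Y.torsionGaloisModule ((2 : ℕ) : ℤ)).toContRepresentation)
    (hψφ : ∀ a, ψ (φ a) = a) (hφψ : ∀ b, φ (ψ b) = b)
    (𝓐 : SelmerStructure (W.torsionGaloisModule ((2 : ℕ) : ℤ)))
    (h𝓐 : ∀ v, 𝓐 v = (Y.kummerSelmerStructure ((2 : ℕ) : ℤ) v).map
      (galoisCohomology.map (φ.restrictField (Place.Completion v)) 1))
    (v₀ : HeightOneSpectrum (𝓞 K)) (hv₀ : ((2 : ℕ) : 𝓞 K) ∉ v₀.asIdeal)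
    (hagree : ∀ v : Place K, v ≠ Sum.inr v₀ → 𝓐 v = W.kummerSelmerStructure ((2 : ℕ) : ℤ) v)
    (htr : 𝓐 (Sum.inr v₀) ⊓ W.kummerSelmerStructure ((2 : ℕ) : ℤ) (Sum.inr v₀) = ⊥)
    (hpair : ∃ x ∈ (W.kummerSelmerStructure ((2 : ℕ) : ℤ)).selmerGroup,
      ∃ y ∈ (W.kummerSelmerStructure ((2 : ℕ) : ℤ)).selmerGroup,
        galoisCohomology.localization (W.torsionGaloisModule ((2 : ℕ) : ℤ)) (Sum.inr v₀) 1 x ≠ 0 ∧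
        galoisCohomology.localization (W.torsionGaloisModule ((2 : ℕ) : ℤ)) (Sum.inr v₀) 1 y ≠ 0 ∧
        galoisCohomology.localization (W.torsionGaloisModule ((2 : ℕ) : ℤ)) (Sum.inr v₀) 1 x ≠
          galoisCohomology.localization (W.torsionGaloisModule ((2 : ℕ) : ℤ)) (Sum.inr v₀) 1 y ∧
        galoisCohomology.localization (W.torsionGaloisModule ((2 : ℕ) : ℤ)) (Sum.inr v₀) 1 (x + y) ≠ 0) :
    Nat.card (Y.selmerGroup ((2 : ℕ) : ℤ)) * 4 = Nat.card (W.selmerGroup ((2 : ℕ) : ℤ)) :=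
  natCard_selmerGroup_mul_four_eq_of_transverse_of_pair W Y (poitouTate_selmerStructure_duality_real_holds (K := K)) (localEP K) φ ψ hψφ hφψ 𝓐 h𝓐 v₀ hv₀
    hagree htr hpair

end Down

section Twist

variable {K : Type} [Field K] [NumberField K] (W : WeierstrassCurve K) [W.IsElliptic]

/-- **Mazur–Rubin Cor. 3.4 (i), DOWN BY TWO, for the twist pair `(E, E^{(d)})` at `p = 2`, place-menu form, over every
number field `K`, UNCONDITIONALLY** — `natCard_selmerGroup_twist_mul_four_eq_of_places` with its two duality binders discharged
(§0): good `v₀ ∤ 2` with `v₀(d)` odd, every other finite place split / both-good off `2` / silent, every infinite place split or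
`H¹`-trivial, two Selmer classes spanning the Klein four-group at `v₀` ⟹ `#Sel₂(Wd) · 4 = #Sel₂(W)` for any elliptic model
`Wd` of `W^{(d)}`. [cite: MazurRubin2010, Lemmas 2.10–2.11, Prop. 3.3, Cor. 3.4 (i), Prop. 5.2 (arXiv:0904.3709 pp. 6–9, 12)]
[cite: MilneADT2006, Ch. I, Thm. 2.8 and Thm. 4.10] -/
theorem natCard_selmerGroup_twist_mul_four_eq_of_places_unconditional
    {d : K} (hd : d ≠ 0) {Wd : WeierstrassCurve K} [Wd.IsElliptic] {C : VariableChange K}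
    (hWd : C • W.quadraticTwist d = Wd)
    (v₀ : HeightOneSpectrum (𝓞 K)) (hv₀ : ((2 : ℕ) : 𝓞 K) ∉ v₀.asIdeal) (hW : W.HasGoodReductionAt v₀)
    (hram : ∃ π c : K, v₀.valuation K π = WithZero.exp (-1 : ℤ) ∧ d = c ^ 2 * π)
    (hfin : ∀ v : HeightOneSpectrum (𝓞 K), v ≠ v₀ →
      (∃ s : v.adicCompletion K, s ^ 2 = algebraMap K (v.adicCompletion K) d) ∨
      (((2 : ℕ) : 𝓞 K) ∉ v.asIdeal ∧ W.HasGoodReductionAt v ∧ Wd.HasGoodReductionAt v) ∨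
      (((2 : ℕ) : 𝓞 K) ∉ v.asIdeal ∧
        Nat.card (nsmulAddMonoidHom 2 : (W.baseChange (v.adicCompletion K)).toAffine.Point →+ _).ker = 1 ∧
        Nat.card (nsmulAddMonoidHom 2 : (Wd.baseChange (v.adicCompletion K)).toAffine.Point →+ _).ker = 1))
    (hinf : ∀ w : InfinitePlace K,
      (∃ s : w.Completion, s ^ 2 = algebraMap K w.Completion d) ∨
      ((∀ x : galoisCohomology (W.localGaloisModule w.Completion) 1, x = 0) ∧
        (∀ x : galoisCohomology (Wd.localGaloisModule w.Completion) 1, x = 0)))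
    (hpair : ∃ x ∈ (W.kummerSelmerStructure ((2 : ℕ) : ℤ)).selmerGroup,
      ∃ y ∈ (W.kummerSelmerStructure ((2 : ℕ) : ℤ)).selmerGroup,
        galoisCohomology.localization (W.torsionGaloisModule ((2 : ℕ) : ℤ)) (Sum.inr v₀) 1 x ≠ 0 ∧
        galoisCohomology.localization (W.torsionGaloisModule ((2 : ℕ) : ℤ)) (Sum.inr v₀) 1 y ≠ 0 ∧
        galoisCohomology.localization (W.torsionGaloisModule ((2 : ℕ) : ℤ)) (Sum.inr v₀) 1 x ≠
          galoisCohomology.localization (W.torsionGaloisModule ((2 : ℕ) : ℤ)) (Sum.inr v₀) 1 y ∧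
        galoisCohomology.localization (W.torsionGaloisModule ((2 : ℕ) : ℤ)) (Sum.inr v₀) 1 (x + y) ≠ 0) :
    Nat.card (Wd.selmerGroup ((2 : ℕ) : ℤ)) * 4 = Nat.card (W.selmerGroup ((2 : ℕ) : ℤ)) :=
  natCard_selmerGroup_twist_mul_four_eq_of_places W (poitouTate_selmerStructure_duality_real_holds (K := K)) (localEP K) hd hWd v₀ hv₀ hW hram hfin hinf hpair

end Twist

/-! ## §2 The `ρ̄₂`-onto lowering prime over `ℚ` — unconditional -/

section Rat

variable (W : WeierstrassCurve ℚ) [W.IsElliptic] [W.IsGloballyMinimal]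

/-- **The lowering prime of Mazur–Rubin Prop. 5.2 for `ρ̄_{E,2}` onto, UNCONDITIONALLY**: two distinct non-zero classes
`x, y ∈ Sel₂(W)` and a modulus `m ≠ 0` give a good prime `p ≡ 1 (mod m)`, `p ∤ 2m`, with `#Sel₂(W^{(p)}) · 4 = #Sel₂(W)`
(`exists_prime_card_selmerGroup_quadraticTwist_mul_four_eq` with the duality binders discharged).
[cite: MazurRubin2010, Prop. 5.2 (proof, arXiv:0904.3709 p. 12) with Lemma 3.6 (p. 9)] -/
theorem exists_prime_card_selmerGroup_quadraticTwist_mul_four_eq_unconditional (hsurj : W.HasSurjectiveModNGaloisRep 2)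
    {x y : galH1Torsion W (2 : ℤ)} (hxS : x ∈ W.selmerGroup 2) (hyS : y ∈ W.selmerGroup 2)
    (hx : x ≠ 0) (hy : y ≠ 0) (hxy : x ≠ y) {m : ℕ} (hm : m ≠ 0) :
    ∃ p : ℕ, p.Prime ∧ (p : ℤ) ≡ 1 [ZMOD (m : ℤ)] ∧ ¬ p ∣ 2 * m ∧
      (∀ _h : Fact p.Prime, W.HasGoodReductionAtPrime p) ∧
      Nat.card ((W.quadraticTwist (p : ℚ)).selmerGroup 2) * 4 = Nat.card (W.selmerGroup 2) :=
  exists_prime_card_selmerGroup_quadraticTwist_mul_four_eq W (poitouTate_selmerStructure_duality_real_holds (K := ℚ)) (localEP ℚ) hsurj hxS hyS hx hy hxy hm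

/-- **Mazur–Rubin Prop. 5.2 for `ρ̄_{E,2}` onto and `W` globally minimal, UNCONDITIONALLY**: `#Sel₂(W) = 2^s`, `s > 1`,
`m ≠ 0` ⟹ a prime `p ≡ 1 (mod m)` with `#Sel₂(W^{(p)}) = 2^{s−2}` (`prop52_of_hasSurjectiveModNGaloisRep` with the duality
binders discharged; the printed `E(ℚ)[2] = 0` form is the sibling file's `MazurRubin2010.prop52_rat_holds`).
[cite: MazurRubin2010, Prop. 5.2 (arXiv:0904.3709 p. 12)] -/
theorem prop52_of_hasSurjectiveModNGaloisRep_unconditional (hsurj : W.HasSurjectiveModNGaloisRep 2)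
    (s : ℕ) (hSel : Nat.card (W.selmerGroup 2) = 2 ^ s) (hs : 1 < s) (m : ℕ) (hm : m ≠ 0) :
    ∃ p : ℕ, p.Prime ∧ (p : ℤ) ≡ 1 [ZMOD (m : ℤ)] ∧
      Nat.card ((W.quadraticTwist (p : ℚ)).selmerGroup 2) = 2 ^ (s - 2) :=
  prop52_of_hasSurjectiveModNGaloisRep (poitouTate_selmerStructure_duality_real_holds (K := ℚ)) (localEP ℚ) W hsurj s hSel hs m hm

end Rat

/-! ## §3 (SUPPLY) and the registered stub A from {Modularity, 2-parity, Cassels–Tate} ∧ (CONV₂) -/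

/-- **(SUPPLY) FOR THE HABITAT FROM THREE PRINT FACTS.** For `W/ℚ` globally minimal, non-CM, `r_an(W) = 0`, `ρ_{W,2^n}` onto
for all `n ≥ 1`: a Kolyvagin-(H2)-admissible Heegner field `K` and a globally minimal twin `Wd ≅ W^{(d_K)}` with `#Sel₂(Wd) = 2`
— GRANTED ONLY Modularity `exists_isNewformOf`, the `2`-parity theorem `p_parity · 2` and the Cassels–Tate pairing
`exists_casselsTate_pairing` (`minimalSelmerTwinSupply_of_duality` with Poitou–Tate and Tate χ discharged, §0).
[cite: MazurRubin2010, Prop. 5.2 (proof, arXiv:0904.3709 p. 12) with Lemma 3.6 and Cor. 3.4 (i)]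
[cite: DokchitserDokchitserAnnals2010, Thm. 1.4] [cite: GrossLMS1991, §1 (p. 235)] -/
theorem minimalSelmerTwinSupply_of_print (hmod : exists_isNewformOf)
    (hpar : ∀ V : WeierstrassCurve ℚ, p_parity V 2) (hCT : exists_casselsTate_pairing (K := ℚ)) :
    ∀ (W : WeierstrassCurve ℚ) [W.IsElliptic] [W.IsGloballyMinimal] [NeZero (W.conductorNorm ℤ)],
      ¬ W.HasCM → W.analyticRank = 0 → (∀ n : ℕ, 0 < n → W.HasSurjectiveModNGaloisRep ((2 : ℤ) ^ n)) →
      ∃ (K : Type) (_ : Field K) (_ : NumberField K),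
        IsImaginaryQuadratic K ∧ Odd (NumberField.discr K) ∧ NumberField.discr K ≠ -3 ∧
        SatisfiesHeegnerHypothesis (W.conductorNorm ℤ) K ∧
        ¬ IsSquare ((NumberField.discr K : ℚ) * -|W.Δ|) ∧ ¬ IsSquare ((NumberField.discr K : ℚ) * (-(2 * |W.Δ|))) ∧
        ∃ (Wd : WeierstrassCurve ℚ) (_ : Wd.IsElliptic) (_ : Wd.IsGloballyMinimal),
          (∃ C : WeierstrassCurve.VariableChange ℚ, C • W.quadraticTwist (NumberField.discr K : ℚ) = Wd) ∧
          Nat.card (Wd.selmerGroup 2) = 2 :=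
  minimalSelmerTwinSupply_of_duality hmod hpar hCT (poitouTate_selmerStructure_duality_real_holds (K := ℚ)) (localEP ℚ)

/-- **STUB A ⟸ Modularity ∧ `2`-parity ∧ Cassels–Tate ∧ (CONV₂).** The registered stub `stub_minimalTwinSupplyAtTwo` of line
`genus-supply` (crux 22136) VERBATIM from three PRINT facts (displayed) and the rank-one `2`-converse `hconv` (OPEN: items
19220/24948, here without the reduction-type clause) — `stub_minimalTwinSupplyAtTwo_of_duality_of_twoConverse` with Poitou–Tate
and Tate χ discharged (§0). So stub A's only non-print input is the `2`-converse. BSD is not proved by any of this.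
[cite: MazurRubin2010, Prop. 5.2 (proof) with Lemma 3.6] [cite: DokchitserDokchitserAnnals2010, Thm. 1.4] -/
theorem stub_minimalTwinSupplyAtTwo_of_print_of_twoConverse (hmod : exists_isNewformOf)
    (hpar : ∀ V : WeierstrassCurve ℚ, p_parity V 2) (hCT : exists_casselsTate_pairing (K := ℚ))
    (hconv : ∀ (V : WeierstrassCurve ℚ) [V.IsElliptic] [V.IsGloballyMinimal],
      ¬ V.HasCM → V.selmerCorank 2 = 1 → V.analyticRank = 1) :
    ∀ (W : WeierstrassCurve ℚ) [W.IsElliptic] [W.IsGloballyMinimal] [NeZero (W.conductorNorm ℤ)],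
      ¬ W.HasCM → W.analyticRank = 0 → (∀ n : ℕ, 0 < n → W.HasSurjectiveModNGaloisRep ((2 : ℤ) ^ n)) →
      ∃ (K : Type) (_ : Field K) (_ : NumberField K),
        IsImaginaryQuadratic K ∧ Odd (NumberField.discr K) ∧ NumberField.discr K ≠ -3 ∧
        SatisfiesHeegnerHypothesis (W.conductorNorm ℤ) K ∧
        ¬ IsSquare ((NumberField.discr K : ℚ) * -|W.Δ|) ∧ ¬ IsSquare ((NumberField.discr K : ℚ) * (-(2 * |W.Δ|))) ∧
        ∃ (Wd : WeierstrassCurve ℚ) (_ : Wd.IsElliptic) (_ : Wd.IsGloballyMinimal),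
          (∃ C : WeierstrassCurve.VariableChange ℚ, C • W.quadraticTwist (NumberField.discr K : ℚ) = Wd) ∧
          Wd.analyticRank = 1 ∧ Nat.card (Wd.selmerGroup 2) = 2 :=
  stub_minimalTwinSupplyAtTwo_of_duality_of_twoConverse hmod hpar hCT (poitouTate_selmerStructure_duality_real_holds (K := ℚ)) (localEP ℚ) hconv

/-! ## §4 The crux BY NAME from route items only -/

/-- **THE CRUX `GenusPrimitiveSupplyAtTwo` BY NAME modulo Modularity ∧ `2`-parity ∧ Cassels–Tate ∧ Gross–Zagier (print,
displayed) ∧ (CONV₂) ∧ (U)** — `genusPrimitiveSupplyAtTwo_of_duality_of_twoConverse_of_multiGenus` with Poitou–Tate and Tate χ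
discharged (§0). (CONV₂) = the rank-one `2`-converse for non-CM curves (items 19220/24948 combined); (U) = multi-genus
`2`-primitivity on the habitat (item 24947's statement verbatim). CONDITIONAL; crux 22136 is OPEN exactly at (CONV₂) ∧ (U).
BSD is not proved by any of this. [cite: MazurRubin2010, Prop. 5.2 (proof) with Lemma 3.6] [cite: GrossZagier1986, Thm. I.6.3]
[cite: DokchitserDokchitserAnnals2010, Thm. 1.4] [cite: GrossLMS1991, §3 (3.5), §4 (4.1)] -/
theorem genusPrimitiveSupplyAtTwo_of_print_of_twoConverse_of_multiGenus (hmod : exists_isNewformOf)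
    (hpar : ∀ V : WeierstrassCurve ℚ, p_parity V 2) (hCT : exists_casselsTate_pairing (K := ℚ))
    (hGZ : ∀ (W : WeierstrassCurve ℚ) [NeZero (W.conductorNorm ℤ)] (K : Type) [Field K] [NumberField K],
      gross_zagier (W.conductorNorm ℤ) W K)
    (hconv : ∀ (V : WeierstrassCurve ℚ) [V.IsElliptic] [V.IsGloballyMinimal],
      ¬ V.HasCM → V.selmerCorank 2 = 1 → V.analyticRank = 1)
    (hU : MultiGenusPrimitivityAtTwo) : GenusPrimitiveSupplyAtTwo :=
  genusPrimitiveSupplyAtTwo_of_duality_of_twoConverse_of_multiGenus hmod hpar hCT (poitouTate_selmerStructure_duality_real_holds (K := ℚ)) (localEP ℚ) hGZ hconv hU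

/-- **THE CRUX BY NAME FROM ROUTE ITEMS ONLY**: `MultiGenusPrimitivityAtTwo → RankOneTwoConverse →
RankOneTwoConverseOffSemistableAtTwo → ModularityExistsNewform → TwoParityDD → CasselsTatePairingRat → GrossZagierAllLevels →
GenusPrimitiveSupplyAtTwo` — every displayed antecedent is an item of route `GenusKolyvaginAtTwo` (24947, 19220, 24948, 19382,
24949, 19420, 24148); the glue item 24951's chain with `MazurRubinProp52Rat` (24950, now CLOSED proved) dropped and
`GrossZagierAllLevels` in its place (`genusPrimitiveSupplyAtTwo_of_kernels_of_duality` with Poitou–Tate and Tate χ discharged;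
equivalently `GenusKoly.genusPrimitiveSupplyAtTwo_of_split'` with `mazurRubinProp52Rat_proof` fed). CONDITIONAL on its
antecedents; the non-print ones are (U) and (CONV₂). BSD is not proved by any of this.
[cite: MazurRubin2010, Prop. 5.2] [cite: GrossZagier1986, Thm. I.6.3] [cite: GrossLMS1991, §3 (3.5), §4 (4.1)] -/
theorem genusPrimitiveSupplyAtTwo_of_kernels :
    MultiGenusPrimitivityAtTwo → RankOneTwoConverse → RankOneTwoConverseOffSemistableAtTwo → ModularityExistsNewform → TwoParityDD →
      CasselsTatePairingRat → GrossZagierAllLevels → GenusPrimitiveSupplyAtTwo :=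
  fun hU h1 h2 hmod hpar hCT hGZ ↦
    genusPrimitiveSupplyAtTwo_of_kernels_of_duality hU h1 h2 hmod hpar hCT hGZ (poitouTate_selmerStructure_duality_real_holds (K := ℚ)) (localEP ℚ)

/-! ## R-128 retype (director-bsd 2026-08-29 17:42Z, T-Q381-1′; seat bsd-line-gk2-p2 g21): PRINT-FORM TWINS
Every theorem below is the byte-identical twin of the theorem of the same name without the trailing prime, with the ONE change
that the `2`-parity hypothesis is typed as print has it — `∀ (V : WeierstrassCurve ℚ) [V.IsElliptic], p_parity V 2`
(Dokchitser–Dokchitser 2010 Thm. 1.4, elliptic curves; = route item `TwoParityDD` after rev 34) — instead of the bare closure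
`∀ V : WeierstrassCurve ℚ, p_parity V 2` over all Weierstrass cubics (singular ones included: off print, undischargeable).
Calls to other retyped theorems go to their primed twins; every application `hpar W` is at an elliptic curve, so the proofs are
unchanged. The unprimed originals are kept (append-only tree) and are superseded by these. BSD is NOT proved by any of this. -/

/-- **R-128 retype** (director-bsd 2026-08-29, T-Q381-1′) of `minimalSelmerTwinSupply_of_print`: the SAME statement and proof with the `2`-parity hypothesis in PRINT form `∀ (V : WeierstrassCurve ℚ) [V.IsElliptic], p_parity V 2` (Dokchitser–Dokchitser 2010 Thm. 1.4 is about elliptic curves; the bare closure over all Weierstrass cubics was off print). **(SUPPLY) FOR THE HABITAT FROM THREE PRINT FACTS.** For `W/ℚ` globally minimal, non-CM, `r_an(W) = 0`, `ρ_{W,2^n}` onto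
for all `n ≥ 1`: a Kolyvagin-(H2)-admissible Heegner field `K` and a globally minimal twin `Wd ≅ W^{(d_K)}` with `#Sel₂(Wd) = 2`
— GRANTED ONLY Modularity `exists_isNewformOf`, the `2`-parity theorem `p_parity · 2` and the Cassels–Tate pairing
`exists_casselsTate_pairing` (`minimalSelmerTwinSupply_of_duality'` with Poitou–Tate and Tate χ discharged, §0).
[cite: MazurRubin2010, Prop. 5.2 (proof, arXiv:0904.3709 p. 12) with Lemma 3.6 and Cor. 3.4 (i)]
[cite: DokchitserDokchitserAnnals2010, Thm. 1.4] [cite: GrossLMS1991, §1 (p. 235)] -/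
theorem minimalSelmerTwinSupply_of_print' (hmod : exists_isNewformOf)
    (hpar : ∀ (V : WeierstrassCurve ℚ) [V.IsElliptic], p_parity V 2) (hCT : exists_casselsTate_pairing (K := ℚ)) :
    ∀ (W : WeierstrassCurve ℚ) [W.IsElliptic] [W.IsGloballyMinimal] [NeZero (W.conductorNorm ℤ)],
      ¬ W.HasCM → W.analyticRank = 0 → (∀ n : ℕ, 0 < n → W.HasSurjectiveModNGaloisRep ((2 : ℤ) ^ n)) →
      ∃ (K : Type) (_ : Field K) (_ : NumberField K),
        IsImaginaryQuadratic K ∧ Odd (NumberField.discr K) ∧ NumberField.discr K ≠ -3 ∧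
        SatisfiesHeegnerHypothesis (W.conductorNorm ℤ) K ∧
        ¬ IsSquare ((NumberField.discr K : ℚ) * -|W.Δ|) ∧ ¬ IsSquare ((NumberField.discr K : ℚ) * (-(2 * |W.Δ|))) ∧
        ∃ (Wd : WeierstrassCurve ℚ) (_ : Wd.IsElliptic) (_ : Wd.IsGloballyMinimal),
          (∃ C : WeierstrassCurve.VariableChange ℚ, C • W.quadraticTwist (NumberField.discr K : ℚ) = Wd) ∧
          Nat.card (Wd.selmerGroup 2) = 2 :=
  minimalSelmerTwinSupply_of_duality' hmod hpar hCT (poitouTate_selmerStructure_duality_real_holds (K := ℚ)) (localEP ℚ)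

/-- **R-128 retype** (director-bsd 2026-08-29, T-Q381-1′) of `stub_minimalTwinSupplyAtTwo_of_print_of_twoConverse`: the SAME statement and proof with the `2`-parity hypothesis in PRINT form `∀ (V : WeierstrassCurve ℚ) [V.IsElliptic], p_parity V 2` (Dokchitser–Dokchitser 2010 Thm. 1.4 is about elliptic curves; the bare closure over all Weierstrass cubics was off print). **STUB A ⟸ Modularity ∧ `2`-parity ∧ Cassels–Tate ∧ (CONV₂).** The registered stub `stub_minimalTwinSupplyAtTwo` of line
`genus-supply` (crux 22136) VERBATIM from three PRINT facts (displayed) and the rank-one `2`-converse `hconv` (OPEN: items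
19220/24948, here without the reduction-type clause) — `stub_minimalTwinSupplyAtTwo_of_duality_of_twoConverse'` with Poitou–Tate
and Tate χ discharged (§0). So stub A's only non-print input is the `2`-converse. BSD is not proved by any of this.
[cite: MazurRubin2010, Prop. 5.2 (proof) with Lemma 3.6] [cite: DokchitserDokchitserAnnals2010, Thm. 1.4] -/
theorem stub_minimalTwinSupplyAtTwo_of_print_of_twoConverse' (hmod : exists_isNewformOf)
    (hpar : ∀ (V : WeierstrassCurve ℚ) [V.IsElliptic], p_parity V 2) (hCT : exists_casselsTate_pairing (K := ℚ))
    (hconv : ∀ (V : WeierstrassCurve ℚ) [V.IsElliptic] [V.IsGloballyMinimal],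
      ¬ V.HasCM → V.selmerCorank 2 = 1 → V.analyticRank = 1) :
    ∀ (W : WeierstrassCurve ℚ) [W.IsElliptic] [W.IsGloballyMinimal] [NeZero (W.conductorNorm ℤ)],
      ¬ W.HasCM → W.analyticRank = 0 → (∀ n : ℕ, 0 < n → W.HasSurjectiveModNGaloisRep ((2 : ℤ) ^ n)) →
      ∃ (K : Type) (_ : Field K) (_ : NumberField K),
        IsImaginaryQuadratic K ∧ Odd (NumberField.discr K) ∧ NumberField.discr K ≠ -3 ∧
        SatisfiesHeegnerHypothesis (W.conductorNorm ℤ) K ∧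
        ¬ IsSquare ((NumberField.discr K : ℚ) * -|W.Δ|) ∧ ¬ IsSquare ((NumberField.discr K : ℚ) * (-(2 * |W.Δ|))) ∧
        ∃ (Wd : WeierstrassCurve ℚ) (_ : Wd.IsElliptic) (_ : Wd.IsGloballyMinimal),
          (∃ C : WeierstrassCurve.VariableChange ℚ, C • W.quadraticTwist (NumberField.discr K : ℚ) = Wd) ∧
          Wd.analyticRank = 1 ∧ Nat.card (Wd.selmerGroup 2) = 2 :=
  stub_minimalTwinSupplyAtTwo_of_duality_of_twoConverse' hmod hpar hCT (poitouTate_selmerStructure_duality_real_holds (K := ℚ)) (localEP ℚ) hconv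

/-- **R-128 retype** (director-bsd 2026-08-29, T-Q381-1′) of `genusPrimitiveSupplyAtTwo_of_print_of_twoConverse_of_multiGenus`: the SAME statement and proof with the `2`-parity hypothesis in PRINT form `∀ (V : WeierstrassCurve ℚ) [V.IsElliptic], p_parity V 2` (Dokchitser–Dokchitser 2010 Thm. 1.4 is about elliptic curves; the bare closure over all Weierstrass cubics was off print). **THE CRUX `GenusPrimitiveSupplyAtTwo` BY NAME modulo Modularity ∧ `2`-parity ∧ Cassels–Tate ∧ Gross–Zagier (print,
displayed) ∧ (CONV₂) ∧ (U)** — `genusPrimitiveSupplyAtTwo_of_duality_of_twoConverse_of_multiGenus'` with Poitou–Tate and Tate χ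
discharged (§0). (CONV₂) = the rank-one `2`-converse for non-CM curves (items 19220/24948 combined); (U) = multi-genus
`2`-primitivity on the habitat (item 24947's statement verbatim). CONDITIONAL; crux 22136 is OPEN exactly at (CONV₂) ∧ (U).
BSD is not proved by any of this. [cite: MazurRubin2010, Prop. 5.2 (proof) with Lemma 3.6] [cite: GrossZagier1986, Thm. I.6.3]
[cite: DokchitserDokchitserAnnals2010, Thm. 1.4] [cite: GrossLMS1991, §3 (3.5), §4 (4.1)] -/
theorem genusPrimitiveSupplyAtTwo_of_print_of_twoConverse_of_multiGenus' (hmod : exists_isNewformOf)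
    (hpar : ∀ (V : WeierstrassCurve ℚ) [V.IsElliptic], p_parity V 2) (hCT : exists_casselsTate_pairing (K := ℚ))
    (hGZ : ∀ (W : WeierstrassCurve ℚ) [NeZero (W.conductorNorm ℤ)] (K : Type) [Field K] [NumberField K],
      gross_zagier (W.conductorNorm ℤ) W K)
    (hconv : ∀ (V : WeierstrassCurve ℚ) [V.IsElliptic] [V.IsGloballyMinimal],
      ¬ V.HasCM → V.selmerCorank 2 = 1 → V.analyticRank = 1)
    (hU : MultiGenusPrimitivityAtTwo) : GenusPrimitiveSupplyAtTwo :=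
  genusPrimitiveSupplyAtTwo_of_duality_of_twoConverse_of_multiGenus' hmod hpar hCT (poitouTate_selmerStructure_duality_real_holds (K := ℚ)) (localEP ℚ) hGZ hconv hU


end Summit.BirchSwinnertonDyer.BirchSwinnertonDyer.Theorems.GenusKolyLowering

end
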